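import Summits.ValiantsHypothesis.ValiantsHypothesis.Theorems.BarrierLeverPartitionMinorsHitByVPHiddenStatesBallPlusFree
import Summits.ValiantsHypothesis.ValiantsHypothesis.Theorems.BarrierLeverPartitionMinorsHitByVPHiddenStatesAddRowFree

/-!
# Route BarrierLever — item `PartitionMinorsHitByVP` (stmt-ValiantsHypothesis-19717), line `hidden_states`:
# «BALL-TILED CORE ⊔ ANYTHING», strong form — the tiled core need NOT be a lower set

Helper file (`--supports stmt-ValiantsHypothesis-19717`; cell valiant-natproofs, rung V4, 𝒟-side door (c); prover seat val-np-p6 gen 9).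
Definition-free. Closes NO item. Strengthens `SymbJoin.ballTiling_node` (p603335) by the STRONG add-row lemma (`symGood_addRow_free`,
`symGood_goodCore_free`, file `…HiddenStatesAddRowFree`): free points absorb arbitrary rows, so the hypothesis «the union of the shifted
copies is a lower set» disappears.

**`SymbJoin.ballTiling_node'`.** Fix `h ≥ 1`, ball types `(n_p, s_p)_{p < n}` with `n_p ≤ h`, `n + 1 ≤ 2h`, slack `F ≤ h + 1`,
`r = Σ_p |B_{s_p}([n_p])| + F`. The legal design «join of the balls ⊔ star with F points» (`m = n + 1`, `K = h`) has a nonsingular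
block-additive matrix at some table for EVERY injective `u : Fin r → Finset (Fin h)` containing pairwise-distinct faithful shifted copies
`C_p ∪ σ_p(J)` of the members `J` of the pieces — NOTHING is assumed about the other `F` rows or about how the copies sit inside `u`.
Special case (one ball): every injective family of `|B_t([n])| + F` subsets of `Fin h` (`n ≤ h`, `F ≤ h+1`) that contains SOME shifted copy
`C ∪ σ(B_t([n]))` (`σ` injective on `[n]`, image disjoint from `C`) is served by `B_t(n) ⊔ star`.

WHAT THIS IS NOT: a class theorem (families containing a ball tiling of all but ≤ h+1 of their members); a fixed design tiles only
exponentially few families of its size; item 19717 OPEN; nothing on crux 14610 or VP ≠ VNP.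
-/

set_option linter.dupNamespace false

namespace Summit.ValiantsHypothesis.ValiantsHypothesis.Theorems.BarrierLever.HiddenStates

open Finset Matrix MvPolynomial

noncomputable section

namespace SymbJoin

/-- **«BALL-TILED CORE ⊔ ANYTHING», strong form (node-shaped class theorem, all `h`).** The members of ball piece `p` are the
`J ⊆ Fin h` with all elements `< n_p` and `|J| ≤ s_p`; the shifted copies must be rows of `u` and pairwise distinct — nothing else. -/
theorem ballTiling_node' (h n F r : ℕ) (hh : 1 ≤ h) (nn ss : Fin n → ℕ) (hnn : ∀ p, nn p ≤ h) (hn : n + 1 ≤ h + h)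
    (hF : F ≤ h + 1)
    (hr : r = ∑ p : Fin n, (Finset.univ.filter fun J : Finset (Fin h) => (∀ q ∈ J, (q : ℕ) < nn p) ∧ J.card ≤ ss p).card + F) :
    ∃ (m K : ℕ) (W : Fin m → ℕ) (wt : Fin m → Fin K → ℕ) (e : Fin r → Fin m × Finset (Fin K)),
      m ≤ h + h ∧ K ≤ h * h * h ∧ Function.Injective e ∧
      (∀ x : Fin m × Finset (Fin K), x ∉ Set.range e →
        ∀ i, W (e i).1 + ∑ k ∈ (e i).2, wt (e i).1 k < W x.1 + ∑ k ∈ x.2, wt x.1 k) ∧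
      ∀ u : Fin r → Finset (Fin h), Function.Injective u →
        (∃ (Cst : Fin n → Finset (Fin h)) (σ : Fin n → Fin h → Fin h),
          (∀ (p : Fin n) (J : Finset (Fin h)), (∀ q ∈ J, (q : ℕ) < nn p) → J.card ≤ ss p →
              Cst p ∪ J.image (σ p) ∈ Set.range u) ∧
          (∀ (p p' : Fin n) (J J' : Finset (Fin h)), (∀ q ∈ J, (q : ℕ) < nn p) → J.card ≤ ss p →
              (∀ q ∈ J', (q : ℕ) < nn p') → J'.card ≤ ss p' →
              Cst p ∪ J.image (σ p) = Cst p' ∪ J'.image (σ p') → p = p' ∧ J = J')) →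
        ∃ tx : Fin m → Option (Fin K) → Fin h → ℂ,
          (Matrix.of fun i k : Fin r =>
            ∏ a ∈ u i, (tx (e k).1 none a + ∑ q ∈ (e k).2, tx (e k).1 (some q) a)).det ≠ 0 := by
  classical
  -- members of the ball pieces
  let Mem : Fin n → Finset (Fin h) → Prop := fun p J => (∀ q ∈ J, (q : ℕ) < nn p) ∧ J.card ≤ ss p
  let Ball : Fin n → Finset (Finset (Fin h)) := fun p => Finset.univ.filter fun J => Mem p J
  have hBall_mem : ∀ p J, J ∈ Ball p ↔ Mem p J := fun p J => by simp [Ball]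
  -- the star points
  let star : Fin F → Finset (Fin h) := fun j =>
    if hj : (j : ℕ) = 0 then (∅ : Finset (Fin h)) else {⟨(j : ℕ) - 1, by omega⟩}
  have hstar_inj : Function.Injective star := starPt_injective hF
  have hstar_card : ∀ j, (star j).card ≤ 1 := starPt_card_le_one hF
  -- member set S = S0 (balls, piece p.castSucc) ∪ S1 (star, piece last)
  let S0 : Finset (Fin (n + 1) × Finset (Fin h)) :=
    Finset.univ.biUnion fun p : Fin n => (Ball p).image fun J => (p.castSucc, J)
  let S1 : Finset (Fin (n + 1) × Finset (Fin h)) := (Finset.univ : Finset (Fin F)).image fun j => (Fin.last n, star j)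
  have hS0_mem : ∀ x, x ∈ S0 ↔ ∃ p : Fin n, x.1 = p.castSucc ∧ Mem p x.2 := by
    intro x
    simp only [S0, Finset.mem_biUnion, Finset.mem_univ, true_and, Finset.mem_image, hBall_mem]
    constructor
    · rintro ⟨p, J, hJ, rfl⟩; exact ⟨p, rfl, hJ⟩
    · rintro ⟨p, h1, h2⟩; exact ⟨p, x.2, h2, by ext <;> simp [h1]⟩
  have hS1_mem : ∀ x, x ∈ S1 ↔ x.1 = Fin.last n ∧ ∃ j, star j = x.2 := by
    intro x
    simp only [S1, Finset.mem_image, Finset.mem_univ, true_and]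
    constructor
    · rintro ⟨j, rfl⟩; exact ⟨rfl, j, rfl⟩
    · rintro ⟨h1, j, hj⟩; exact ⟨j, by ext <;> simp [h1, hj]⟩
  have hS01 : Disjoint S0 S1 := by
    rw [Finset.disjoint_left]
    intro x hx0 hx1
    obtain ⟨p, hp, _⟩ := (hS0_mem x).mp hx0
    have h1 := ((hS1_mem x).mp hx1).1
    rw [hp] at h1
    exact absurd (congrArg Fin.val h1) (by simp; omega)
  have hS0card : S0.card = ∑ p : Fin n, (Ball p).card := by
    rw [Finset.card_biUnion]
    · exact Finset.sum_congr rfl fun p _ => Finset.card_image_of_injective _ fun J J' hJ => by simpa using hJ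
    · intro p _ p' _ hpp'
      rw [Function.onFun, Finset.disjoint_left]
      intro x hx hx'
      obtain ⟨J, _, rfl⟩ := Finset.mem_image.mp hx
      obtain ⟨J', _, hJ'⟩ := Finset.mem_image.mp hx'
      exact hpp' (Fin.castSucc_injective _ (congrArg Prod.fst hJ').symm)
  have hS1card : S1.card = F := by
    rw [Finset.card_image_of_injective _ (fun j j' hjj' => hstar_inj (by simpa using congrArg Prod.snd hjj')),
      Finset.card_univ, Fintype.card_fin]
  set S := S0 ∪ S1 with hS
  have hScard : S.card = r := by
    rw [hS, Finset.card_union_of_disjoint hS01, hS0card, hS1card, hr]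
  let eqv : Fin r ≃ S := (Fin.castOrderIso hScard.symm).toEquiv.trans S.equivFin.symm
  let e : Fin r → Fin (n + 1) × Finset (Fin h) := fun i => (eqv i).1
  have he_mem : ∀ i, e i ∈ S := fun i => (eqv i).2
  have he_inj : Function.Injective e := fun i j hij => eqv.injective (Subtype.ext hij)
  have he_symm : ∀ y : S, e (eqv.symm y) = y.1 := fun y => by simp [e]
  have he_surj : ∀ x ∈ S, ∃ i, e i = x := fun x hx => ⟨eqv.symm ⟨x, hx⟩, he_symm _⟩
  have hmemS : ∀ x, x ∈ S ↔ x ∈ S0 ∨ x ∈ S1 := fun x => by rw [hS, Finset.mem_union]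
  -- effective radius and weights
  let T : ℕ := h + 1
  let W : Fin (n + 1) → ℕ := Fin.lastCases (if F = 0 then T + 1 else T - 1) fun p => T - min (ss p) (nn p)
  let wt : Fin (n + 1) → Fin h → ℕ :=
    Fin.lastCases (fun q => if (q : ℕ) + 1 < F then 1 else T + 1) fun p q => if (q : ℕ) < nn p then 1 else T + 1
  have hmin_le : ∀ p, min (ss p) (nn p) ≤ h := fun p => (min_le_right _ _).trans (hnn p)
  refine ⟨n + 1, h, W, wt, e, hn,
    le_trans (le_trans (Nat.le_mul_of_pos_right h hh) (Nat.le_mul_of_pos_right _ hh)) (le_of_eq (by ring)),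
    he_inj, ?_, ?_⟩
  · -- joint strict threshold: used ≤ T < T + 1 ≤ unused
    rintro ⟨x1, x2⟩ hx i
    have hxS : (x1, x2) ∉ S := fun hxS => by obtain ⟨j, hj⟩ := he_surj _ hxS; exact hx ⟨j, hj⟩
    have hused : W (e i).1 + ∑ k ∈ (e i).2, wt (e i).1 k ≤ T := by
      rcases (hmemS _).mp (he_mem i) with h0 | h1
      · obtain ⟨p, hp, hlt, hcard⟩ := (hS0_mem _).mp h0
        rw [hp]
        simp only [W, wt, Fin.lastCases_castSucc]
        have hsum : ∑ k ∈ (e i).2, (if (k : ℕ) < nn p then 1 else T + 1) = (e i).2.card := by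
          rw [Finset.card_eq_sum_ones]
          exact Finset.sum_congr rfl fun k hk => by rw [if_pos (hlt k hk)]
        rw [hsum]
        have hcard' : (e i).2.card ≤ nn p := by
          calc (e i).2.card ≤ (Finset.range (nn p)).card :=
                Finset.card_le_card_of_injOn (fun q : Fin h => (q : ℕ)) (fun q hq => Finset.mem_range.mpr (hlt q hq))
                  (fun q _ q' _ hqq' => Fin.ext hqq')
            _ = nn p := Finset.card_range _
        have := hmin_le p
        omega
      · obtain ⟨h1, j, hj⟩ := (hS1_mem _).mp h1
        have hF0 : F ≠ 0 := by have := j.2; omega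
        rw [h1]
        simp only [W, wt, Fin.lastCases_last, hF0, if_false, ← hj]
        by_cases hj0 : (j : ℕ) = 0
        · simp [star, hj0]
        · simp only [star, hj0, dif_neg, not_false_eq_true, Finset.sum_singleton]
          rw [if_pos (by have := j.2; omega)]
          omega
    have hunused : T + 1 ≤ W x1 + ∑ k ∈ x2, wt x1 k := by
      rw [hmemS, not_or] at hxS
      obtain ⟨hx0, hx1⟩ := hxS
      rw [hS0_mem] at hx0
      rw [hS1_mem] at hx1
      push Not at hx0 hx1
      induction x1 using Fin.lastCases with
      | last =>
        simp only [W, wt, Fin.lastCases_last]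
        by_cases hF0 : F = 0
        · rw [if_pos hF0]; omega
        · rw [if_neg hF0]
          have hne : ∀ j : Fin F, star j ≠ x2 := hx1 rfl
          have hge1 : ∀ k ∈ x2, 1 ≤ (if (k : ℕ) + 1 < F then 1 else T + 1) := fun k _ => by split_ifs <;> omega
          have hsum_ge : x2.card ≤ ∑ k ∈ x2, (if (k : ℕ) + 1 < F then 1 else T + 1) := by
            have := Finset.card_nsmul_le_sum x2 _ 1 hge1
            simpa using this
          have hne0 : x2 ≠ ∅ := fun h0 => hne ⟨0, Nat.pos_of_ne_zero hF0⟩ (by simp [star, h0])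
          rcases Nat.lt_or_ge x2.card 2 with hc | hc
          · have hc1 : x2.card = 1 := by
              have := Finset.nonempty_iff_ne_empty.mpr hne0 |>.card_pos; omega
            obtain ⟨q, hq⟩ := Finset.card_eq_one.mp hc1
            have hqF : ¬ (q : ℕ) + 1 < F := fun hqF => hne ⟨(q : ℕ) + 1, hqF⟩ (by simp [star, hq])
            rw [hq, Finset.sum_singleton, if_neg hqF]
            omega
          · omega
      | cast p =>
        simp only [W, wt, Fin.lastCases_castSucc]
        have hnot : ¬ Mem p x2 := hx0 p rfl
        by_cases hlt : ∀ q ∈ x2, (q : ℕ) < nn p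
        · have hcard : ss p < x2.card := by
            by_contra hle; exact hnot ⟨hlt, by omega⟩
          have hsum : ∑ k ∈ x2, (if (k : ℕ) < nn p then 1 else T + 1) = x2.card := by
            rw [Finset.card_eq_sum_ones]
            exact Finset.sum_congr rfl fun k hk => by rw [if_pos (hlt k hk)]
          rw [hsum]
          have : min (ss p) (nn p) ≤ ss p := min_le_left _ _
          have := hmin_le p
          omega
        · push Not at hlt
          obtain ⟨q, hq, hqn⟩ := hlt
          have hterm : T + 1 ≤ ∑ k ∈ x2, (if (k : ℕ) < nn p then 1 else T + 1) := by
            calc T + 1 = (if (q : ℕ) < nn p then 1 else T + 1) := by rw [if_neg (by omega)]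
              _ ≤ ∑ k ∈ x2, (if (k : ℕ) < nn p then 1 else T + 1) :=
                Finset.single_le_sum (f := fun k : Fin h => if (k : ℕ) < nn p then 1 else T + 1)
                  (fun k _ => Nat.zero_le _) hq
          omega
    dsimp only at hused ⊢
    omega
  · -- the class
    rintro u hu ⟨Cst, σ, hin, hinj⟩
    set r₀ := S0.card with hr₀
    let gB : Fin r₀ ≃ S0 := S0.equivFin.symm
    have hgB : ∀ c, ∃ p : Fin n, ((gB c : S0) : Fin (n + 1) × Finset (Fin h)).1 = p.castSucc ∧
        Mem p ((gB c : S0) : Fin (n + 1) × Finset (Fin h)).2 :=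
      fun c => (hS0_mem _).mp (gB c).2
    choose pc hpc hMemc using hgB
    have hmem0 : ∀ c : Fin r₀, ((gB c : S0) : Fin (n + 1) × Finset (Fin h)) ∈ S := fun c =>
      (hmemS _).mpr (Or.inl (gB c).2)
    let col : Fin r₀ → Fin r := fun c => eqv.symm ⟨_, hmem0 c⟩
    have hecol : ∀ c, e (col c) = ((gB c : S0) : Fin (n + 1) × Finset (Fin h)) := fun c => he_symm _
    have hcol : Function.Injective col := by
      intro c c' hcc'
      have := congrArg e hcc'
      rw [hecol, hecol] at this
      exact gB.injective (Subtype.ext this)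
    have hrowex : ∀ c : Fin r₀, ∃ i, u i = Cst (pc c) ∪ ((gB c : S0) : Fin (n + 1) × Finset (Fin h)).2.image (σ (pc c)) :=
      fun c => by obtain ⟨i, hi⟩ := hin (pc c) _ (hMemc c).1 (hMemc c).2; exact ⟨i, hi⟩
    choose row hurow using hrowex
    have hrow : Function.Injective row := by
      intro c c' hcc'
      have h1 := hurow c
      rw [hcc', hurow c'] at h1
      obtain ⟨hp, hJ⟩ := hinj _ _ _ _ (hMemc c').1 (hMemc c').2 (hMemc c).1 (hMemc c).2 h1
      apply gB.injective
      apply Subtype.ext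
      exact Prod.ext (by rw [hpc c, hpc c', hp]) hJ.symm
    let Cst' : Fin (n + 1) → Finset (Fin h) := Fin.lastCases ∅ Cst
    let σ' : Fin (n + 1) → Fin h → Fin h := Fin.lastCases id σ
    refine exists_table_of_goodCore_free u hu e row col hrow hcol
      (symGood_of_tiling (fun c => u (row c)) (hu.comp hrow) (fun c => e (col c)) Cst' σ' ?_) ?_
    · -- tiling
      intro c a
      rw [hurow c, hecol c, hpc c]
      simp [Cst', σ', Finset.mem_union, Finset.mem_image]
    · -- star columns are affinely free in the star piece
      intro k hk
      rcases (hmemS _).mp (he_mem k) with h0 | h1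
      · exfalso; apply hk
        exact ⟨gB.symm ⟨e k, h0⟩, he_inj (by rw [hecol]; simp)⟩
      · obtain ⟨h1k, j, hj⟩ := (hS1_mem _).mp h1
        have hother : ∀ k', k' ≠ k → (e k').1 = (e k).1 → ∃ j' : Fin F, j' ≠ j ∧ (e k').2 = star j' := by
          intro k' hk' hp
          rcases (hmemS _).mp (he_mem k') with h0' | h1'
          · obtain ⟨p, hp', _⟩ := (hS0_mem _).mp h0'
            rw [hp, h1k] at hp'
            exact absurd (congrArg Fin.val hp') (by simp; omega)
          · obtain ⟨_, j', hj'⟩ := (hS1_mem _).mp h1'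
            refine ⟨j', fun hjj => hk' (he_inj ?_), hj'.symm⟩
            ext
            · rw [hp]
            · rw [← hj', ← hj, hjj]
        by_cases hj0 : (j : ℕ) = 0
        · refine ⟨fun o => Option.elim o 1 fun _ => -1, ?_, ?_⟩
          · rw [← hj]; simp [phi, star, hj0]
          · intro k' hk' hp
            obtain ⟨j', hj'ne, hk'2⟩ := hother k' hk' hp
            have hj'0 : (j' : ℕ) ≠ 0 := fun h0 => hj'ne (Fin.ext (by rw [h0, hj0]))
            rw [hk'2]; simp [phi, star, hj'0]
        · refine ⟨fun o => Option.elim o 0 fun q' => if (q' : ℕ) = (j : ℕ) - 1 then 1 else 0, ?_, ?_⟩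
          · rw [← hj]
            simp only [phi, star, dif_neg hj0, Finset.sum_singleton, Option.elim]
            simp
          · intro k' hk' hp
            obtain ⟨j', hj'ne, hk'2⟩ := hother k' hk' hp
            rw [hk'2]
            by_cases hj'0 : (j' : ℕ) = 0
            · simp [phi, star, hj'0]
            · have hne' : (j' : ℕ) - 1 ≠ (j : ℕ) - 1 := fun h' => hj'ne (Fin.ext (by omega))
              simp [phi, star, hj'0, hne']

end SymbJoin

end

end Summit.ValiantsHypothesis.ValiantsHypothesis.Theorems.BarrierLever.HiddenStates
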